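import Summits.QuantumFields.YangMills.Theses.LangevinControlUV
import Summits.QuantumFields.YangMills.Theorems.OSLegsFromFemtoAndGap.Negative.UnitsAndGapFree

/-!
# `OSLegsAtWeakCouplingC` — negative-side support: H1 is (cheaply) load-bearing

Support file for crux `stmt-QuantumFields-16207`
(`Summit.QuantumFields.YangMills.Theses.LangevinControlUV.OSLegsAtWeakCouplingC`, route LangevinControlUV,
rank 6; the C′ re-type of `OSLegsFromFemtoAndGap` stmt-9367: `Continuous a →` inserted,
`sch.HasWeakCouplingLimit ∧` added), extracted from the standing disprover's work file
`Cruxes/OSLegsAtWeakCouplingC/Disproof.lean` §2. Tree objects only, nothing posited; the hypothesis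
bodies H2 (skewness witness), H3 (gap in units `a`) and the conclusion of the crux are quoted VERBATIM.

* `osLegsC_false_without_twoPoint`: the statement obtained from the C-crux by deleting the femto
  two-point package H1 (keeping `Continuous a`, H2, H3 and the weak-coupling conclusion verbatim) is
  FALSE — at `G = SU(2)`, `r` fundamental and the CONTINUOUS unit map `a ≡ 0`: H2 holds with `Γ₃ = id`,
  H3 with rate `c₁ · 0` (bounded torus correlations, `abs_latticeConnectedCorr_le`), while every scheme
  has `sch.a 0 > 0 ≠ a (β_0)`. The clause isolated is the positivity `∀ β, 0 < a β` of H1; whether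
  the two-sided BOUNDS of H1 are used is formally undecidable today (any witness of H1 ∧ H2 ∧ H3 for a
  genuine `G` proves the lattice mass gap at all weak couplings). Sibling of the predecessor's
  `OSLegsFromFemtoAndGap.Negative.osLegs_false_without_twoPoint` (p72925), which it neither implies
  nor is implied by (extra hypothesis `Continuous a`, stronger conclusion). [folklore]
-/

noncomputable section

open MeasureTheory Filter Topology
open Literature.MathematicalPhysics.AQFT Literature.MathematicalPhysics.QuantumLattice
open Literature.MathematicalPhysics.QuantumFieldTheory

namespace Summit.QuantumFields.YangMills.Theorems.OSLegsAtWeakCouplingC.Negative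

/-- **`OSLegsAtWeakCouplingC` without H1 is false** (unconditional: `SU(2)` fundamental, the
continuous unit map `a ≡ 0`; H2, H3 and the conclusion verbatim). [folklore] -/
theorem osLegsC_false_without_twoPoint :
    ¬ (∀ (G : Type) [Group G] [TopologicalSpace G] [IsTopologicalGroup G] [CompactSpace G], IsCompactSimpleLieGroup G → letI : MeasurableSpace G := borel G; haveI : BorelSpace G := ⟨rfl⟩; ∀ (r : LatticeRep G), ∀ (a : ℝ → ℝ), Continuous a → (∃ (Γ₃ : ℝ → ℝ) (β₁ ℓ₁ c₃ : ℝ), 0 < ℓ₁ ∧ 0 < c₃ ∧ (∀ s : ℝ, 0 < s → s ≤ ℓ₁ → 0 < Γ₃ s) ∧ ∀ (L : ℕ) [NeZero L] (β : ℝ), β₁ ≤ β → (L : ℝ) * a β ≤ ℓ₁ → let P : (Fin 4 → ZMod L) → Fin 4 → Fin 4 → GaugeConfig 4 L G → ℝ := fun x i j U => (r.N : ℝ) - (r.ρ (plaquetteHolonomy U x i j)).trace.re; let E : (GaugeConfig 4 L G → ℝ) → ℝ := fun F => wilsonExpectation (d := 4) (L := L) r.ρ β F; let cov : (GaugeConfig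 4 L G → ℝ) → (GaugeConfig 4 L G → ℝ) → ℝ := fun F F' => E (fun U => F U * F' U) - E F * E F'; ∀ n : ℕ, 1 ≤ n → 8 * n ≤ L → c₃ * Γ₃ ((n : ℝ) * a β) ≤ (n : ℝ) ^ 12 * |E (fun U => P 0 0 1 U * P (Pi.single (2 : Fin 4) ((n : ℕ) : ZMod L)) 0 1 U * P (Pi.single (3 : Fin 4) ((n : ℕ) : ZMod L)) 0 1 U) - E (P 0 0 1) * cov (P (Pi.single (2 : Fin 4) ((n : ℕ) : ZMod L)) 0 1) (P (Pi.single (3 : Fin 4) ((n : ℕ) : ZMod L)) 0 1) - E (P (Pi.single (2 : Fin 4) ((n : ℕ) : ZMod L)) 0 1) * cov (P 0 0 1) (P (Pi.single (3 : Fin 4) ((n : ℕ) : ZMod L)) 0 1) - E (P (Pi.single (3 : Fin 4) ((n : ℕ) : ZMod L)) 0 1) * cov (P 0 0 1) (P (Pi.single (2 : Fin 4) ((n : ℕ) : ZMod L)) 0 1) - E (P 0 0 1) * E (P (Pi.single (2 : Fin 4) ((n : ℕ) : ZMod L)) 0 1) * E (P (Pi.single (3 : Fin 4) ((n : ℕ)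 : ZMod L)) 0 1)|) → (∃ (c₁ β₂ : ℝ) (S₁ : ℝ → ℕ), 0 < c₁ ∧ ∀ A B : YMSpecies G, ∃ C : ℝ, ∀ β : ℝ, β₂ ≤ β → ∀ S n : ℕ, S₁ β ≤ S → n ≤ S → |latticeConnectedCorr r.ρ β (2 * S + 1) A.F B.F n| ≤ C * Real.exp (-(c₁ * a β * n))) → ∃ (sch : SpeciesScheme (YMSpecies G)) (T : OSData (YMSpecies G) 4), (∀ k, sch.a k = a (sch.β k)) ∧ sch.HasWeakCouplingLimit ∧ IsYangMillsFor r sch T ∧ T.IsNontrivial r.curvature ∧ T.IsNonGaussian r.curvature ∧ ∃ Δ > 0, HasLatticeMassGap r sch Δ) := by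
  intro h
  letI : MeasurableSpace (Matrix.specialUnitaryGroup (Fin 2) ℂ) := borel _
  haveI : BorelSpace (Matrix.specialUnitaryGroup (Fin 2) ℂ) := ⟨rfl⟩
  -- the fundamental representation of SU(2) as lattice representation data
  let r₂ : LatticeRep (Matrix.specialUnitaryGroup (Fin 2) ℂ) :=
    ⟨2, fundamentalRep (Fin 2), continuous_fundamentalRep _, fundamentalRep_injective _,
      fundamentalRep_mem_unitaryGroup⟩
  have h2 := h _ OSLegsFromFemtoAndGap.Negative.isCompactSimpleLieGroup_su2 r₂ (fun _ => 0)
    continuous_const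
  have hSk := fun hS hG => (h2 hS hG).elim fun sch hsch => hsch.elim fun T hT => (sch.a_pos 0).ne' (hT.1 0)
  refine hSk ?_ ?_
  · refine ⟨fun s => s, 0, 1, 1, one_pos, one_pos, fun s hs _ => hs, ?_⟩
    intro L _ β _ _ P E cov n _ _
    simp only [mul_zero]
    positivity
  · refine ⟨1, 0, fun _ => 0, one_pos, fun A B => ?_⟩
    obtain ⟨CA, hCA⟩ := A.bounded
    obtain ⟨CB, hCB⟩ := B.bounded
    refine ⟨2 * (CA * CB), fun β _ S n _ _ => ?_⟩
    simpa using HypercubicLimit.Negative.abs_latticeConnectedCorr_le r₂ β (2 * S + 1) hCA hCB n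

end Summit.QuantumFields.YangMills.Theorems.OSLegsAtWeakCouplingC.Negative

end
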